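import Literature.Geometry.Symplectic.GromovCompactnessSpheres
import Literature.Geometry.Symplectic.SymplecticArea
import Literature.Geometry.Symplectic.ExactNoJSpheres
import Literature.Topology.FourManifolds.ComplexProjectiveSpaceOrientationProofs
import HarnessLib

/-!
# Gromov compactness for `J`-spheres, dichotomy form — proofs, I: the energy and its zero stratum

Sibling proof file of `GromovCompactnessSpheres.lean` (the named fact
`Literature.Geometry.Symplectic.gromovCompactness_spheres_dichotomy`, McDuff–Salamon (2012),
Thm. 5.3.1 with Def. 5.1.1 and Thm. 5.2.2). It formalises, in the EXACT two-chart vocabulary of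
that fact (pairs `u v : ℂ → X` with `v z = u z⁻¹`, glued maps `F : ℂℙ¹ → X` over the tree's
`Literature.Topology.FourManifolds.ComplexProjectiveSpace 1`, `J`-holomorphy
`Literature.Geometry.Symplectic.IsJHolomorphic`, taming `AlmostComplexStructure.IsTamedBy`), the first
steps of the printed proof — the ENERGY of a sphere as a homological quantity and the case of
zero energy:

* **The symplectic energy is the period of `[ω]`** (McDuff–Salamon (2012), Lemma 2.2.1,
  `E(u) = ∫_{S²} u^*ω = ⟨[ω], u_*[S²]⟩` for `J`-holomorphic `u` and `ω`-tame `J`). The tree's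
  `periodFunctional ω` (`SymplecticArea.lean`: `z ↦ ⟨[ω], z ⊗ 1⟩` through de Rham's integration
  isomorphism) is the homological side; this file proves what the compactness argument consumes of
  the identity, sign-free (for EVERY `ℤ`-orientation of `ℂℙ¹`, the tree's orientations being defined
  up to an undecidable sign):
  - `period_eq_of_homotopic` — the period is constant on a homotopy class (so the hypothesis
    "`Fₙ ≃ F₀`" of the fact is the energy bound `sup E(uᵛ) < ∞` of Thm. 5.3.1);
  - `twoChartSphere_const_of_period_eq_zero` / `twoChartSphere_period_ne_zero_of_ne` — **a
    `J`-holomorphic sphere of zero period is constant; a non-constant one has non-zero period**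
    (positivity of the energy of non-constant `J`-curves);
  - `period_eq_zero_of_const` — constants have zero period.
* **The zero-energy stratum of the dichotomy**: `gromovCompactness_spheres_dichotomy_of_period_eq_zero`
  proves the conclusion of the fact VERBATIM (alternative (A), identity reparametrisations) when the
  common class has zero period: all spheres are then constant, and constants subconverge in the
  compact `X`.

The analytic core of Thm. 5.3.1 for POSITIVE energy (mean-value inequality and energy quantum,
removal of singularities, elliptic regularity / the generalized Weierstraß theorem — the tree's
unproved fact `JHolomorphicWeierstrassR4` —, bubbling and the no-energy-loss on necks,
McDuff–Salamon (2012), Ch. 4 and §5.3; Hummel (1997), Ch. II–V) is NOT here.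

## Method (the positivity argument, McDuff–Salamon (2012), Lemma 2.2.1 / (2017), §4.5 (4.5.4))

For a `C^∞` two-chart sphere `(u, v)` with glued map `F`, `F` is `C^∞` on `ℂℙ¹`
(`TwoChartSphere.contMDiff_glued`); at a point `x`, in the preferred affine chart `i = chartIndex x`,
`F = uᵢ ∘ (p ↦ pⱼ/pᵢ)` near `x`, so `dF_x = d(uᵢ)_z ∘ Λ` with `Λ : ℝ² → ℂ` the complex reading of
real coordinates (`TwoChartSphere.hasMFDerivAt_glued`), and the pulled-back form on the standard
frame `(e₀, e₁) ↔ (1, i)` is `(F^*ω)_x(e₀, e₁) = ω(ξ, du(i)) = ω(ξ, J ξ)`, `ξ = duᵢ(1)`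
(`TwoChartSphere.pullback_apply_basisFun`, `J`-holomorphy), which is `≥ 0` by taming and `> 0`
unless `dF_x = 0`. A smooth top form which is non-negative for a continuous orientation and
positive somewhere has positive integral (the tree's `MForm.integral_pos_of_sign_mul_apply_nonneg`,
Lee (2013), Prop. 16.6), hence is not exact (Stokes, `MForm.integral_eq_zero_of_mem_exactSmoothForms_holds`),
hence its de Rham class pairs non-trivially with the fundamental class
(`kroneckerPairing_integrationDeRham_fundamentalClass_ne_zero_of_nonneg`, the tree's detection lemma
`eq_zero_of_kroneckerPairing_coeffChange_fundamentalClass_eq_zero`, Hatcher (2002), Thm. 3.26);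
the orientation used is the constant (complex) one of `ℂℙⁿ`, continuous because the affine atlas
has chart changes of positive Jacobian (`isContinuousOrientation_const_complexProjectiveSpace`, from
the tree's `ComplexProjectiveSpace.det_tangentCoordChange_pos`). If `u` is not constant, some
`du_z ≠ 0` (a `C¹` map `ℂ → X` with `du ≡ 0` is constant), hence `dF ≠ 0` at `[1 : z]` (chain rule
through `z ↦ [1 : z]`, `TwoChartSphere.mfderiv_eq_comp_sigma`), and the period is non-zero.

Everything here is proved: no definitions, no named facts (D-0026). Dimensions and degrees on
`ℂℙ¹` are spelled `2 * 1`, the key under which its manifold instances are registered.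

## References

* D. McDuff, D. Salamon, *J-holomorphic Curves and Symplectic Topology*, 2nd ed., AMS Colloquium
  Publ. 52 (2012), Lemma 2.2.1, §4.1, Thm. 5.3.1. [McDuffSalamon2012]
* D. McDuff, D. Salamon, *Introduction to Symplectic Topology*, 3rd ed., OUP (2017), §4.5
  eq. (4.5.4). [McDuffSalamon2017]
* C. Hummel, *Gromov's compactness theorem for pseudo-holomorphic curves*, Progress in Math. 151
  (1997), Ch. II §2 (area = energy), Ch. V Thm. 1.2. [Hummel1997]
* J. M. Lee, *Introduction to Smooth Manifolds*, 2nd ed. (2013), Prop. 15.6, Prop. 16.6,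
  Thm. 17.31, Thm. 18.14. [LeeSmoothManifolds2013]
* A. Hatcher, *Algebraic Topology* (2002), Thm. 2.10, Prop. 2.8, §3.3 Thm. 3.26. [HatcherAT2002]
-/

noncomputable section

open scoped Manifold ContDiff Topology EuclideanSpace
open Set Function Module Filter
open Literature.AlgebraicTopology.SingularHomology Literature.Geometry.Kaehler
  Literature.NumberTheory.Transcendental Literature.Geometry.Manifold

namespace Literature.Geometry.Symplectic

/-! ### Linear algebra: signs of top-degree alternating forms on frames -/

section LinearAlgebra

variable {E : Type*} [AddCommGroup E] [Module ℝ E] {ι : Type*} [Fintype ι] [DecidableEq ι]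

/-- A top-degree alternating form is its value on a basis times the basis determinant:
`α(w) = α(b) · det_b(w)` (`AlternatingMap.eq_smul_basis_det`, evaluated). [folklore] -/
theorem apply_eq_apply_basis_mul_det (b : Basis ι ℝ E) (α : E [⋀^ι]→ₗ[ℝ] ℝ) (w : ι → E) :
    α w = α b * b.det w := by
  have h := congrArg (fun f : E [⋀^ι]→ₗ[ℝ] ℝ ↦ f w) (AlternatingMap.eq_smul_basis_det b α)
  simpa only [AlternatingMap.smul_apply, smul_eq_mul] using h

/-- If a top form `α` is non-negative on the basis `b`, then `sign(det_b w) · α(w) ≥ 0` on every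
frame `w` (it is `α(b) · |det_b w|`): non-negativity with respect to the orientation of `b` is
independent of the frame used to test it. [folklore] -/
theorem sign_det_mul_apply_nonneg (b : Basis ι ℝ E) (α : E [⋀^ι]→ₗ[ℝ] ℝ) (h : 0 ≤ α b)
    (w : ι → E) : 0 ≤ Real.sign (b.det w) * α w := by
  rw [apply_eq_apply_basis_mul_det b α w, mul_comm (α b), ← mul_assoc, real_sign_mul_self]
  exact mul_nonneg (abs_nonneg _) h

/-- If a top form `α` is positive on the basis `b`, then `sign(det_b w) · α(w) > 0` on every
BASIS `w` (it is `α(b) · |det_b w|` and `det_b w ≠ 0`). [folklore] -/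
theorem sign_det_mul_apply_pos (b : Basis ι ℝ E) (α : E [⋀^ι]→ₗ[ℝ] ℝ) (h : 0 < α b)
    (w : Basis ι ℝ E) : 0 < Real.sign (b.det w) * α w := by
  rw [apply_eq_apply_basis_mul_det b α w, mul_comm (α b), ← mul_assoc, real_sign_mul_self]
  exact mul_pos (abs_pos.2 (b.isUnit_det w).ne_zero) h

end LinearAlgebra

/-! ### A non-negative, somewhere positive top form is not exact and is detected by `[M]` -/

section TopForm

variable {E : Type*} [NormedAddCommGroup E] [NormedSpace ℝ E] [FiniteDimensional ℝ E]
  {n : ℕ} [Fact (finrank ℝ E = n)]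
  {H : Type*} [TopologicalSpace H] {I : ModelWithCorners ℝ E H}
  {M : Type*} [TopologicalSpace M] [ChartedSpace H M] [IsManifold I ∞ M]
  {o : (x : M) → Orientation ℝ (TangentSpace I x) (Fin n)}
  [MeasurableSpace E] [BorelSpace E] [T2Space M] [CompactSpace M] [I.Boundaryless]

/-- **A smooth top form on a closed oriented manifold which is non-negative for the orientation
and positive at one point is not exact**: its integral is positive (Lee (2013), Prop. 16.6 (c), the
tree's `MForm.integral_pos_of_sign_mul_apply_nonneg`), while exact forms integrate to zero
(Stokes, Cor. 16.13, the tree's `MForm.integral_eq_zero_of_mem_exactSmoothForms_holds`).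
[cite: LeeSmoothManifolds2013, Prop. 16.6 and Cor. 16.13] -/
theorem not_mem_exactSmoothForms_of_sign_mul_apply_nonneg (ho : IsContinuousOrientation o)
    {α : MForm I M ℝ n} (hα : IsSmoothForm α)
    (h0 : ∀ x : M, 0 ≤ Real.sign (orientationForm o x (modelBasis E n)) *
      (show E [⋀^Fin n]→L[ℝ] ℝ from α x) (modelBasis E n))
    (h1 : ∃ x : M, 0 < Real.sign (orientationForm o x (modelBasis E n)) *
      (show E [⋀^Fin n]→L[ℝ] ℝ from α x) (modelBasis E n)) :
    α ∉ exactSmoothForms I M ℝ n := fun hex ↦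
  (MForm.integral_pos_of_sign_mul_apply_nonneg ho hα h0 h1).ne'
    (MForm.integral_eq_zero_of_mem_exactSmoothForms_holds o ho hex)

end TopForm

section Pairing

/-- **`⟨e_M [t], [M] ⊗ 1⟩ ≠ 0` for a smooth closed top form `t` which is non-negative for a
continuous orientation `o` and positive somewhere**, on a closed connected `n`-manifold `M` with
ANY `ℤ`-orientation `μ` (sign-free): `[t] ≠ 0` since `t` is not exact, `e_M` is an isomorphism,
and `Hⁿ(M; ℝ)` is detected by `[M] ⊗ 1` (Hatcher (2002), Thm. 3.26 / the tree's
`eq_zero_of_kroneckerPairing_coeffChange_fundamentalClass_eq_zero`; Lee (2013), Thm. 17.31 with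
Thm. 18.14). The nowhere-vanishing case is the tree's
`kroneckerPairing_integrationDeRham_fundamentalClass_ne_zero`. [cite: LeeSmoothManifolds2013, Thm. 17.31 and Thm. 18.14] -/
theorem kroneckerPairing_integrationDeRham_fundamentalClass_ne_zero_of_nonneg {n : ℕ} {M : Type}
    [TopologicalSpace M] [T2Space M] [CompactSpace M] [ConnectedSpace M]
    [ChartedSpace (EuclideanSpace ℝ (Fin n)) M] [IsManifold (𝓡 n) ∞ M]
    (μ : HomologicalOrientation ℤ M n)
    {o : (x : M) → Orientation ℝ (TangentSpace (𝓡 n) x) (Fin n)}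
    (ho : IsContinuousOrientation (I := 𝓡 n) o) {t : MForm (𝓡 n) M ℝ n}
    (ht : t ∈ closedSmoothForms (𝓡 n) M ℝ n)
    (h0 : ∀ x : M, 0 ≤ Real.sign (orientationForm o x (modelBasis (EuclideanSpace ℝ (Fin n)) n)) *
      (show (EuclideanSpace ℝ (Fin n)) [⋀^Fin n]→L[ℝ] ℝ from t x)
        (modelBasis (EuclideanSpace ℝ (Fin n)) n))
    (h1 : ∃ x : M, 0 < Real.sign (orientationForm o x (modelBasis (EuclideanSpace ℝ (Fin n)) n)) *
      (show (EuclideanSpace ℝ (Fin n)) [⋀^Fin n]→L[ℝ] ℝ from t x)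
        (modelBasis (EuclideanSpace ℝ (Fin n)) n)) :
    kroneckerPairing ℝ ℝ M n
        (integrationDeRhamIsoFamily (EuclideanSpace ℝ (Fin n)) M n (deRhamCohomology.mk ⟨t, ht⟩))
        (singularHomology.coeffChange M (algebraMap ℤ ℝ : ℤ →+* ℝ).toAddMonoidHom n
          μ.fundamentalClass) ≠ 0 := by
  have hmk : deRhamCohomology.mk ⟨t, ht⟩ ≠ 0 := fun h ↦
    not_mem_exactSmoothForms_of_sign_mul_apply_nonneg ho ht.1 h0 h1
      (mem_exactSmoothForms_of_mk_eq_zero _ h)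
  have he : integrationDeRhamIsoFamily (EuclideanSpace ℝ (Fin n)) M n
      (deRhamCohomology.mk ⟨t, ht⟩) ≠ 0 :=
    fun h ↦ hmk ((LinearEquiv.map_eq_zero_iff _).1 h)
  exact fun h ↦ he (eq_zero_of_kroneckerPairing_coeffChange_fundamentalClass_eq_zero ℝ μ h)

variable {k m : ℕ} {S : Type} [TopologicalSpace S] [T2Space S] [CompactSpace S] [ConnectedSpace S]
  [ChartedSpace (EuclideanSpace ℝ (Fin k)) S] [IsManifold (𝓡 k) ∞ S]
  {N : Type} [TopologicalSpace N] [ChartedSpace (EuclideanSpace ℝ (Fin m)) N]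
  [IsManifold (𝓡 m) ∞ N] [T2Space N] [SigmaCompactSpace N]

/-- **Non-zero period of a closed form whose pull-back is a non-negative, somewhere positive top
form.** For a `C^∞` map `f : S → N` from a closed connected `k`-manifold, a closed smooth `k`-form
`α` on `N`, a continuous orientation `o` of `S` for which `f^*α` is non-negative everywhere and
positive somewhere, and ANY `ℤ`-orientation `μS`: `⟨[α], f_*[S] ⊗ 1⟩ = ⟨[f^*α], [S] ⊗ 1⟩ ≠ 0`
(naturality of de Rham's isomorphism, Lee (2013), Thm. 18.14, then
`kroneckerPairing_integrationDeRham_fundamentalClass_ne_zero_of_nonneg`). This is the form in which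
"a non-constant `J`-holomorphic curve has positive energy `∫ u^*ω = ⟨[ω], [u]⟩`" is used below.
[cite: LeeSmoothManifolds2013, Thm. 18.14] -/
theorem periodFunctional_map_fundamentalClass_ne_zero_of_nonneg {f : S → N}
    (hf : ContMDiff (𝓡 k) (𝓡 m) ∞ f) (α : MForm (𝓡 m) N ℝ k) (hα : IsSmoothForm α)
    (hcl : IsClosedForm α) {o : (y : S) → Orientation ℝ (TangentSpace (𝓡 k) y) (Fin k)}
    (ho : IsContinuousOrientation (I := 𝓡 k) o)
    (h0 : ∀ y : S, 0 ≤ Real.sign (orientationForm o y (modelBasis (EuclideanSpace ℝ (Fin k)) k)) *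
      (show (EuclideanSpace ℝ (Fin k)) [⋀^Fin k]→L[ℝ] ℝ from α.pullback (𝓡 k) f y)
        (modelBasis (EuclideanSpace ℝ (Fin k)) k))
    (h1 : ∃ y : S, 0 < Real.sign (orientationForm o y (modelBasis (EuclideanSpace ℝ (Fin k)) k)) *
      (show (EuclideanSpace ℝ (Fin k)) [⋀^Fin k]→L[ℝ] ℝ from α.pullback (𝓡 k) f y)
        (modelBasis (EuclideanSpace ℝ (Fin k)) k))
    (μS : HomologicalOrientation ℤ S k) :
    periodFunctional α hα hcl
      (singularHomology.map ℤ ℤ ⟨f, hf.continuous⟩ k μS.fundamentalClass) ≠ 0 := by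
  haveI : LocallyCompactSpace S := ChartedSpace.locallyCompactSpace (EuclideanSpace ℝ (Fin k)) S
  haveI : SecondCountableTopology S :=
    ChartedSpace.secondCountable_of_sigmaCompact (EuclideanSpace ℝ (Fin k)) S
  haveI : LocallyCompactSpace N := ChartedSpace.locallyCompactSpace (EuclideanSpace ℝ (Fin m)) N
  haveI : SecondCountableTopology N :=
    ChartedSpace.secondCountable_of_sigmaCompact (EuclideanSpace ℝ (Fin m)) N
  rw [periodFunctional_apply, singularHomology.coeffChange_map, realClassOfClosedForm_eq,
    intCastAddHom_real_eq_algebraMap, ← kroneckerPairing_map,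
    ← integrationDeRhamIsoFamily_map_of_contMDiff hf k, deRhamCohomology.map_mk]
  exact kroneckerPairing_integrationDeRham_fundamentalClass_ne_zero_of_nonneg μS ho
    (pullback_mem_closedSmoothForms hf ⟨hα, hcl⟩) h0 h1

end Pairing

section ProjectiveSpace

open Literature.Topology.FourManifolds Literature.Topology.FourManifolds.ComplexProjectiveSpace


/-- **The affine atlas of `ℂℙⁿ` is oriented** (companion of the tree's
`ComplexProjectiveSpace.det_tangentCoordChange_pos`, with the two charts in the other order): for
`x` in the domain of the preferred chart at `x₀`, the Jacobian of the change from the chart at `x₀`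
to the chart at `x`, at `x`, has positive determinant (it is inverse to the one of op. cit., by the
cocycle identity). Milnor–Stasheff §14; Huybrechts (2005), Cor. 1.2.3. [folklore] -/
theorem det_tangentCoordChange_pos_of_mem_source {n : ℕ} {x₀ x : ComplexProjectiveSpace n}
    (hx : x ∈ (chartAt (EuclideanSpace ℝ (Fin (2 * n))) x₀).source) :
    0 < LinearMap.det ((tangentCoordChange (𝓡 (2 * n)) x₀ x x :
        EuclideanSpace ℝ (Fin (2 * n)) →L[ℝ] EuclideanSpace ℝ (Fin (2 * n))) :
      EuclideanSpace ℝ (Fin (2 * n)) →ₗ[ℝ] EuclideanSpace ℝ (Fin (2 * n))) := by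
  have h1 := ComplexProjectiveSpace.det_tangentCoordChange_pos (x := x₀) (y := x) hx
  have hx' : x ∈ (extChartAt (𝓡 (2 * n)) x₀).source := by rwa [extChartAt_source]
  have hc : (tangentCoordChange (𝓡 (2 * n)) x₀ x x).comp (tangentCoordChange (𝓡 (2 * n)) x x₀ x) =
      ContinuousLinearMap.id ℝ (EuclideanSpace ℝ (Fin (2 * n))) := by
    rw [Literature.Topology.FourManifolds.tangentCoordChange_comp_eq
        ⟨⟨mem_extChartAt_source x, hx'⟩, mem_extChartAt_source x⟩,
      Literature.Topology.FourManifolds.tangentCoordChange_self_eq (mem_extChartAt_source x)]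
  have h2 := congrArg (fun A : EuclideanSpace ℝ (Fin (2 * n)) →L[ℝ] EuclideanSpace ℝ (Fin (2 * n)) ↦
    LinearMap.det (A : EuclideanSpace ℝ (Fin (2 * n)) →ₗ[ℝ] EuclideanSpace ℝ (Fin (2 * n)))) hc
  simp only [ContinuousLinearMap.toLinearMap_comp, LinearMap.det_comp,
    ContinuousLinearMap.coe_id, LinearMap.det_id] at h2
  by_contra hle
  push Not at hle
  nlinarith [h1, h2, hle]

/-- **Chart signs of a constant orientation family on `ℂℙⁿ`** are the constant
`sign (o₀(e₁, …, e₂ₙ))` on the whole target of every affine chart (the chart changes having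
positive Jacobian determinant). [folklore] -/
theorem chartSign_const_complexProjectiveSpace {n : ℕ}
    (o₀ : Orientation ℝ (EuclideanSpace ℝ (Fin (2 * n))) (Fin (2 * n))) (x₀ : ComplexProjectiveSpace n)
    {y : EuclideanSpace ℝ (Fin (2 * n))}
    (hy : y ∈ (extChartAt (𝓡 (2 * n)) x₀).target) :
    chartSign (I := 𝓡 (2 * n)) (M := ComplexProjectiveSpace n) (fun _ ↦ o₀) x₀ y =
      Real.sign (o₀.someVector (modelBasis (EuclideanSpace ℝ (Fin (2 * n))) (2 * n))) := by
  have hx : (extChartAt (𝓡 (2 * n)) x₀).symm y ∈ (extChartAt (𝓡 (2 * n)) x₀).source :=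
    (extChartAt (𝓡 (2 * n)) x₀).map_target hy
  have hy' : y = extChartAt (𝓡 (2 * n)) x₀ ((extChartAt (𝓡 (2 * n)) x₀).symm y) :=
    ((extChartAt (𝓡 (2 * n)) x₀).right_inv hy).symm
  have hxc : (extChartAt (𝓡 (2 * n)) x₀).symm y ∈
      (chartAt (EuclideanSpace ℝ (Fin (2 * n))) x₀).source := by
    rwa [extChartAt_source] at hx
  have hpos := det_tangentCoordChange_pos_of_mem_source hxc
  rw [hy', chartSign_extChartAt _ hx, Real.sign_of_pos hpos, one_mul]
  rfl

/-- **`ℂℙⁿ` is oriented by any constant orientation family**: `x ↦ o₀` (the same orientation of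
the model `ℝ²ⁿ` in every affine chart) is a continuous orientation in the sense of the tree's
integration theory `IsContinuousOrientation` (its chart signs are a non-zero constant near every
centre) — the complex orientation of `ℂℙⁿ` when `o₀` is the standard one. Milnor–Stasheff (1974),
§14; the tree's `isOrientable_complexProjectiveSpace_holds` is the same fact for
`SmoothOrientation`. [folklore] -/
theorem isContinuousOrientation_const_complexProjectiveSpace (n : ℕ)
    (o₀ : Orientation ℝ (EuclideanSpace ℝ (Fin (2 * n))) (Fin (2 * n))) :
    IsContinuousOrientation (I := 𝓡 (2 * n)) (M := ComplexProjectiveSpace n) (fun _ ↦ o₀) := by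
  intro x₀
  have hmem : (extChartAt (𝓡 (2 * n)) x₀).target ∈
      𝓝[range (𝓡 (2 * n))] (extChartAt (𝓡 (2 * n)) x₀ x₀) :=
    extChartAt_target_mem_nhdsWithin x₀
  filter_upwards [hmem] with y hy
  rw [chartSign_const_complexProjectiveSpace o₀ x₀ hy,
    chartSign_const_complexProjectiveSpace o₀ x₀ (mem_extChartAt_target x₀)]
  refine ⟨rfl, fun h ↦ ?_⟩
  -- the sign of a representative of `o₀` on the reference frame is non-zero
  rw [Real.sign_eq_zero_iff] at h
  have hψ : (o₀.someVector : EuclideanSpace ℝ (Fin (2 * n)) [⋀^Fin (2 * n)]→ₗ[ℝ] ℝ) = 0 := by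
    rw [AlternatingMap.eq_smul_basis_det (modelBasis (EuclideanSpace ℝ (Fin (2 * n))) (2 * n))
      o₀.someVector, h, zero_smul]
  exact Module.Ray.someVector_ne_zero o₀ hψ

end ProjectiveSpace

section TwoChart

open Literature.Topology.FourManifolds Literature.Topology.FourManifolds.ComplexProjectiveSpace


/-- The complex affine coordinate `p ↦ pⱼ/pᵢ` of `ℂℙ¹` is the real affine chart read through
`Λ : ℝ² → ℂ` (`affineCoord = realCoordinates ∘ affineCoordComplex`). [folklore] -/
theorem affineCoordComplex_apply_zero_eq (i : Fin 2) (p : ComplexProjectiveSpace 1) :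
    affineCoordComplex i p 0 = ((ContinuousLinearMap.proj (0 : Fin 1) : (Fin 1 → ℂ) →L[ℝ] ℂ).comp
      (realCoordinates 1).symm.toContinuousLinearMap) (affineChart (n := 1) i p) := by
  simp only [ContinuousLinearMap.coe_comp, ContinuousLinearEquiv.coe_coe, Function.comp_apply,
    ContinuousLinearMap.proj_apply, affineChart_apply, affineCoord,
    ContinuousLinearEquiv.symm_apply_apply]

/-- Function form of `affineCoordComplex_apply_zero_eq`. [folklore] -/
theorem affineCoordComplex_eq_comp (i : Fin 2) :
    (fun p : ComplexProjectiveSpace 1 ↦ affineCoordComplex i p 0) =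
      ((ContinuousLinearMap.proj (0 : Fin 1) : (Fin 1 → ℂ) →L[ℝ] ℂ).comp
        (realCoordinates 1).symm.toContinuousLinearMap) ∘ (affineChart (n := 1) i) :=
  funext fun p ↦ affineCoordComplex_apply_zero_eq i p

/-- `realCoordinates 1` on `ℂ¹ = ℂ` is `z ↦ (re z, im z)`: its inverse reads
`(w₀, w₁) ↦ w₀ + i w₁` (definitional). [folklore] -/
theorem realCoordinates_one_symm_apply_zero (w : EuclideanSpace ℝ (Fin (2 * 1))) :
    (realCoordinates 1).symm w 0 = ⟨w 0, w 1⟩ := by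
  rfl

/-- The standard frame `(e₀, e₁)` of `ℝ²` is read by `Λ : w ↦ (realCoordinates⁻¹ w)₀` as the
complex frame `(1, i)`. [folklore] -/
theorem lam_basisFun_eq (j : Fin (2 * 1)) :
    ((ContinuousLinearMap.proj (0 : Fin 1) : (Fin 1 → ℂ) →L[ℝ] ℂ).comp
      (realCoordinates 1).symm.toContinuousLinearMap) (PiLp.basisFun 2 ℝ (Fin (2 * 1)) j) =
      ![(1 : ℂ), Complex.I] j := by
  rw [ContinuousLinearMap.comp_apply, ContinuousLinearMap.proj_apply,
    ContinuousLinearEquiv.coe_coe, realCoordinates_one_symm_apply_zero, PiLp.basisFun_apply]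
  fin_cases j
  · apply Complex.ext <;> simp
  · apply Complex.ext <;> simp

/-- The complex affine coordinate `p ↦ pⱼ/pᵢ` is `C^∞` on the chart domain `{pᵢ ≠ 0}` (an atlas
member composed with a linear map). [folklore] -/
theorem contMDiffOn_affineCoordComplex (i : Fin 2) :
    ContMDiffOn (𝓡 (2 * 1)) 𝓘(ℝ, ℂ) ∞ (fun p : ComplexProjectiveSpace 1 ↦ affineCoordComplex i p 0)
      {p | CoordNeZero i p} := by
  rw [affineCoordComplex_eq_comp]
  have h : ContMDiffOn (𝓡 (2 * 1)) (𝓡 (2 * 1)) ∞ (affineChart (n := 1) i)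
      (affineChart (n := 1) i).source :=
    contMDiffOn_of_mem_maximalAtlas
      (IsManifold.subset_maximalAtlas ((mem_atlas_iff _).2 ⟨i, rfl⟩))
  exact (ContinuousLinearMap.contMDiff
    ((ContinuousLinearMap.proj (0 : Fin 1) : (Fin 1 → ℂ) →L[ℝ] ℂ).comp
      (realCoordinates 1).symm.toContinuousLinearMap)).comp_contMDiffOn h

/-- **At a point `x`, the complex coordinate of the PREFERRED affine chart `i = chartIndex x` has
derivative `Λ`** (the preferred chart has derivative the identity in its own trivialisation of the
tangent bundle, `tangentCoordChange_self`). [folklore] -/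
theorem hasMFDerivAt_affineCoordComplex_chartIndex (x : ComplexProjectiveSpace 1) :
    HasMFDerivAt (𝓡 (2 * 1)) 𝓘(ℝ, ℂ)
      (fun p : ComplexProjectiveSpace 1 ↦ affineCoordComplex (chartIndex x) p 0) x
      ((ContinuousLinearMap.proj (0 : Fin 1) : (Fin 1 → ℂ) →L[ℝ] ℂ).comp
        (realCoordinates 1).symm.toContinuousLinearMap) := by
  have h1 : HasMFDerivAt (𝓡 (2 * 1)) 𝓘(ℝ, EuclideanSpace ℝ (Fin (2 * 1))) (extChartAt (𝓡 (2 * 1)) x)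
      x (mfderiv (𝓡 (2 * 1)) (𝓡 (2 * 1)) (chartAt (EuclideanSpace ℝ (Fin (2 * 1))) x) x) :=
    hasMFDerivAt_extChartAt (mem_chart_source _ x)
  rw [mfderiv_chartAt_eq_tangentCoordChange (mem_chart_source _ x),
    Literature.Topology.FourManifolds.tangentCoordChange_self_eq (mem_extChartAt_source x)] at h1
  -- `Λ ∘ (chart at x)` has derivative `Λ ∘ id = Λ`
  have h2 := ((ContinuousLinearMap.hasMFDerivAt
    ((ContinuousLinearMap.proj (0 : Fin 1) : (Fin 1 → ℂ) →L[ℝ] ℂ).comp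
      (realCoordinates 1).symm.toContinuousLinearMap)).comp x h1).congr_mfderiv
        (ContinuousLinearMap.ext fun v ↦ (rfl :
          (((ContinuousLinearMap.proj (0 : Fin 1) : (Fin 1 → ℂ) →L[ℝ] ℂ).comp
            (realCoordinates 1).symm.toContinuousLinearMap).comp
              (ContinuousLinearMap.id ℝ (EuclideanSpace ℝ (Fin (2 * 1))))) v =
          ((ContinuousLinearMap.proj (0 : Fin 1) : (Fin 1 → ℂ) →L[ℝ] ℂ).comp
            (realCoordinates 1).symm.toContinuousLinearMap) v))
  have h3 : (⇑((ContinuousLinearMap.proj (0 : Fin 1) : (Fin 1 → ℂ) →L[ℝ] ℂ).comp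
      (realCoordinates 1).symm.toContinuousLinearMap) ∘ ⇑(extChartAt (𝓡 (2 * 1)) x)) =
        fun p : ComplexProjectiveSpace 1 ↦ affineCoordComplex (chartIndex x) p 0 := by
    funext p
    rw [affineCoordComplex_apply_zero_eq]
    rfl
  rwa [h3] at h2

variable {X : Type} [TopologicalSpace X] [ChartedSpace (EuclideanSpace ℝ (Fin 4)) X]

/-- **The glued map of a `C^∞` two-chart sphere is `C^∞` on `ℂℙ¹`**: a map `G : ℂℙ¹ → X` which on
each affine chart domain `{pᵢ ≠ 0}` is `uvᵢ ∘ (p ↦ pⱼ/pᵢ)` with `uvᵢ : ℂ → X` of class `C^∞`.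
[folklore] -/
theorem contMDiff_glued [IsManifold (𝓡 4) ∞ X] {uv : Fin 2 → ℂ → X}
    (huv : ∀ i, ContMDiff 𝓘(ℝ, ℂ) (𝓡 4) ∞ (uv i)) {G : ComplexProjectiveSpace 1 → X}
    (hG : ∀ i p, CoordNeZero i p → G p = uv i (affineCoordComplex i p 0)) :
    ContMDiff (𝓡 (2 * 1)) (𝓡 4) ∞ G := by
  intro p
  obtain ⟨i, hi⟩ := exists_coordNeZero p
  have hc := ((huv i).comp_contMDiffOn (contMDiffOn_affineCoordComplex i)).contMDiffAt
    ((isOpen_setOf_coordNeZero i).mem_nhds hi)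
  refine hc.congr_of_eventuallyEq ?_
  filter_upwards [(isOpen_setOf_coordNeZero i).mem_nhds hi] with q hq
  exact hG i q hq

/-- **Derivative of a glued map in the preferred chart**: if `G = w ∘ (p ↦ pⱼ/pᵢ)` on the domain of
the preferred chart `i = chartIndex x` and `w` is differentiable at the coordinate `z` of `x`, then
`dG_x = dw_z ∘ Λ`. [folklore] -/
theorem hasMFDerivAt_glued {w : ℂ → X} {G : ComplexProjectiveSpace 1 → X}
    (x : ComplexProjectiveSpace 1)
    (hG : ∀ p, CoordNeZero (chartIndex x) p → G p = w (affineCoordComplex (chartIndex x) p 0))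
    (hw : MDifferentiableAt 𝓘(ℝ, ℂ) (𝓡 4) w (affineCoordComplex (chartIndex x) x 0)) :
    HasMFDerivAt (𝓡 (2 * 1)) (𝓡 4) G x
      ((mfderiv 𝓘(ℝ, ℂ) (𝓡 4) w (affineCoordComplex (chartIndex x) x 0)).comp
        ((ContinuousLinearMap.proj (0 : Fin 1) : (Fin 1 → ℂ) →L[ℝ] ℂ).comp
          (realCoordinates 1).symm.toContinuousLinearMap)) := by
  have hev : G =ᶠ[𝓝 x]
      (w ∘ fun p : ComplexProjectiveSpace 1 ↦ affineCoordComplex (chartIndex x) p 0) := by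
    filter_upwards [(isOpen_setOf_coordNeZero (chartIndex x)).mem_nhds
      (coordNeZero_chartIndex x)] with p hp
    exact hG p hp
  exact (hw.hasMFDerivAt.comp x (hasMFDerivAt_affineCoordComplex_chartIndex x)).congr_of_eventuallyEq
    hev

/-- **The pulled-back `2`-form on the standard frame.** With `G`, `w`, `z` as in
`hasMFDerivAt_glued`: `(G^*ω)_x(e₀, e₁) = ω_{w z}(dw_z(1), dw_z(i))` — the integrand `u^*ω(∂ₛ, ∂ₜ)`
of the energy `E(u) = ∫ u^*ω` (McDuff–Salamon (2012), §2.2). [cite: McDuffSalamon2012, Lemma 2.2.1] -/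
theorem pullback_apply_basisFun (ωX : MForm (𝓡 4) X ℝ 2) {w : ℂ → X}
    {G : ComplexProjectiveSpace 1 → X} (x : ComplexProjectiveSpace 1)
    (hG : ∀ p, CoordNeZero (chartIndex x) p → G p = w (affineCoordComplex (chartIndex x) p 0))
    (hw : MDifferentiableAt 𝓘(ℝ, ℂ) (𝓡 4) w (affineCoordComplex (chartIndex x) x 0)) :
    (ωX.pullback (𝓡 (2 * 1)) G) x (PiLp.basisFun 2 ℝ (Fin (2 * 1))) =
      ωX (w (affineCoordComplex (chartIndex x) x 0))
        ![mfderiv 𝓘(ℝ, ℂ) (𝓡 4) w (affineCoordComplex (chartIndex x) x 0) (1 : ℂ),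
          mfderiv 𝓘(ℝ, ℂ) (𝓡 4) w (affineCoordComplex (chartIndex x) x 0) (Complex.I : ℂ)] := by
  have hGx : G x = w (affineCoordComplex (chartIndex x) x 0) := hG x (coordNeZero_chartIndex x)
  have hv : ∀ j, ((mfderiv 𝓘(ℝ, ℂ) (𝓡 4) w (affineCoordComplex (chartIndex x) x 0)).comp
      ((ContinuousLinearMap.proj (0 : Fin 1) : (Fin 1 → ℂ) →L[ℝ] ℂ).comp
        (realCoordinates 1).symm.toContinuousLinearMap)) (PiLp.basisFun 2 ℝ (Fin (2 * 1)) j) =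
        mfderiv 𝓘(ℝ, ℂ) (𝓡 4) w (affineCoordComplex (chartIndex x) x 0) (![(1 : ℂ), Complex.I] j) :=
    fun j ↦ congrArg (mfderiv 𝓘(ℝ, ℂ) (𝓡 4) w (affineCoordComplex (chartIndex x) x 0))
      (lam_basisFun_eq j)
  calc (ωX.pullback (𝓡 (2 * 1)) G) x (PiLp.basisFun 2 ℝ (Fin (2 * 1)))
      = ωX (G x) (fun j ↦ ((mfderiv 𝓘(ℝ, ℂ) (𝓡 4) w
          (affineCoordComplex (chartIndex x) x 0)).comp
            ((ContinuousLinearMap.proj (0 : Fin 1) : (Fin 1 → ℂ) →L[ℝ] ℂ).comp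
              (realCoordinates 1).symm.toContinuousLinearMap)) (PiLp.basisFun 2 ℝ (Fin (2 * 1)) j)) := by
        rw [MForm.pullback_apply, (hasMFDerivAt_glued x hG hw).mfderiv]
        rfl
    _ = ωX (G x) ![mfderiv 𝓘(ℝ, ℂ) (𝓡 4) w (affineCoordComplex (chartIndex x) x 0) (1 : ℂ),
          mfderiv 𝓘(ℝ, ℂ) (𝓡 4) w (affineCoordComplex (chartIndex x) x 0) (Complex.I : ℂ)] := by
        congr 1
        funext j
        exact (hv j).trans (by fin_cases j <;> rfl)
    _ = _ := by rw [hGx]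



omit [TopologicalSpace X] [ChartedSpace (EuclideanSpace ℝ (Fin 4)) X] in
/-- `σ₀ z = [1 : z]` lies in the chart domain `{p₀ ≠ 0}`. [folklore] -/
theorem coordNeZero_sigma (z : ℂ) :
    CoordNeZero 0 ((fun z : ℂ ↦ (affineChart (n := 1) 0).symm (realCoordinates 1 fun _ ↦ z)) z) :=
  (affineChart (n := 1) 0).map_target (mem_univ _)

omit [TopologicalSpace X] [ChartedSpace (EuclideanSpace ℝ (Fin 4)) X] in
/-- The affine coordinate of `σ₀ z = [1 : z]` is `z`. [folklore] -/
theorem affineCoordComplex_sigma (z : ℂ) :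
    affineCoordComplex 0
      ((fun z : ℂ ↦ (affineChart (n := 1) 0).symm (realCoordinates 1 fun _ ↦ z)) z) 0 = z := by
  rw [affineCoordComplex_apply_zero_eq, (affineChart (n := 1) 0).right_inv (mem_univ _)]
  simp

omit [TopologicalSpace X] [ChartedSpace (EuclideanSpace ℝ (Fin 4)) X] in
/-- `σ₀ : ℂ → ℂℙ¹` is `C^∞` (inverse of an atlas member after a linear map). [folklore] -/
theorem contMDiff_sigma : ContMDiff 𝓘(ℝ, ℂ) (𝓡 (2 * 1)) ∞
    (fun z : ℂ ↦ (affineChart (n := 1) 0).symm (realCoordinates 1 fun _ ↦ z)) := by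
  have h1 : ContMDiffOn (𝓡 (2 * 1)) (𝓡 (2 * 1)) ∞ (affineChart (n := 1) 0).symm
      (affineChart (n := 1) 0).target :=
    contMDiffOn_symm_of_mem_maximalAtlas
      (IsManifold.subset_maximalAtlas ((mem_atlas_iff _).2 ⟨0, rfl⟩))
  have h1' : ContMDiff (𝓡 (2 * 1)) (𝓡 (2 * 1)) ∞ (affineChart (n := 1) 0).symm :=
    contMDiffOn_univ.1 h1
  have h2 : ContMDiff 𝓘(ℝ, ℂ) 𝓘(ℝ, EuclideanSpace ℝ (Fin (2 * 1))) ∞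
      (fun z : ℂ ↦ realCoordinates 1 (fun _ : Fin 1 ↦ z)) :=
    ((realCoordinates 1).contDiff.comp (contDiff_pi.2 fun _ ↦ contDiff_id)).contMDiff
  exact h1'.comp h2

/-- **Chain rule through the chart `z ↦ [1 : z]`**: for the glued map `F` of a two-chart sphere
`(u, v)`, `du_z = dF_{[1:z]} ∘ dσ₀_z`. [folklore] -/
theorem mfderiv_eq_comp_sigma [IsManifold (𝓡 4) ∞ X] {u : ℂ → X} {F : ComplexProjectiveSpace 1 → X}
    (hF : ContMDiff (𝓡 (2 * 1)) (𝓡 4) ∞ F)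
    (hF0 : ∀ p, CoordNeZero 0 p → F p = u (affineCoordComplex 0 p 0)) (z : ℂ) :
    mfderiv 𝓘(ℝ, ℂ) (𝓡 4) u z =
      (mfderiv (𝓡 (2 * 1)) (𝓡 4) F
          ((fun z : ℂ ↦ (affineChart (n := 1) 0).symm (realCoordinates 1 fun _ ↦ z)) z)).comp
        (mfderiv 𝓘(ℝ, ℂ) (𝓡 (2 * 1))
          (fun z : ℂ ↦ (affineChart (n := 1) 0).symm (realCoordinates 1 fun _ ↦ z)) z) := by
  have hu : u = F ∘ (fun z : ℂ ↦ (affineChart (n := 1) 0).symm (realCoordinates 1 fun _ ↦ z)) := by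
    funext w
    rw [Function.comp_apply, hF0 _ (coordNeZero_sigma w), affineCoordComplex_sigma]
  rw [hu]
  exact mfderiv_comp z ((hF _).mdifferentiableAt (by simp))
    ((contMDiff_sigma z).mdifferentiableAt (by simp))

variable [T2Space X] [CompactSpace X] [IsManifold (𝓡 4) ∞ X]

/-- **A `J`-holomorphic two-chart sphere of zero symplectic period is constant** (the energy
identity `E(u) = ∫ u^*ω = ⟨[ω], [u]⟩` for a closed taming form `ω`, McDuff–Salamon (2012),
Lemma 2.2.1; McDuff–Salamon (2017), §4.5 (4.5.4); non-constant `J`-curves have positive energy).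
Let `ωX` be a smooth closed `2`-form on the compact `4`-manifold `X` taming the almost complex
structure `JX`, `(u, v)` a `C^∞` `JX`-holomorphic two-chart sphere (`v z = u z⁻¹`) with glued map
`F : ℂℙ¹ → X`. If `⟨[ωX], F_*[ℂℙ¹]⟩ = 0` for some `ℤ`-orientation of `ℂℙ¹`, then `u` is constant.
Proof: `F` is `C^∞`; in the preferred affine chart at `x`, `F = u_i ∘ (p ↦ p_j/p_i)` and the
pull-back `F^*ωX` evaluated on the complex frame is `ωX(ξ, JX ξ) ≥ 0`, `ξ = du_i(1)` (taming),
positive unless `dF_x = 0`; were `u` not constant, some `du_z ≠ 0`, hence some `dF_x ≠ 0`, so the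
non-negative top form `F^*ωX` would be positive somewhere, hence not exact (Stokes), hence of
non-zero period (de Rham) — contradiction. [cite: McDuffSalamon2012, Lemma 2.2.1] -/
theorem twoChartSphere_const_of_period_eq_zero
    (ωX : MForm (𝓡 4) X ℝ 2) (JX : AlmostComplexStructure (𝓡 4) ∞ X)
    (hω : IsSmoothForm ωX) (hcl : IsClosedForm ωX) (htame : JX.IsTamedBy ωX)
    {u v : ℂ → X} {F : C(ComplexProjectiveSpace 1, X)}
    (hu : ContMDiff 𝓘(ℝ, ℂ) (𝓡 4) ∞ u) (hv : ContMDiff 𝓘(ℝ, ℂ) (𝓡 4) ∞ v)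
    (hJu : IsJHolomorphic (𝓡 4) (fun y ↦ JX y) u) (hJv : IsJHolomorphic (𝓡 4) (fun y ↦ JX y) v)
    (hF0 : ∀ p, CoordNeZero 0 p → F p = u (affineCoordComplex 0 p 0))
    (hF1 : ∀ p, CoordNeZero 1 p → F p = v (affineCoordComplex 1 p 0))
    (μ : HomologicalOrientation ℤ (ComplexProjectiveSpace 1) (2 * 1))
    (hper : periodFunctional ωX hω hcl
      (singularHomology.map ℤ ℤ F (2 * 1) μ.fundamentalClass) = 0) :
    ∀ z, u z = u 0 := by
  -- the two charts as a family
  set uv : Fin 2 → ℂ → X := ![u, v] with huv_def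
  have huv : ∀ i, ContMDiff 𝓘(ℝ, ℂ) (𝓡 4) ∞ (uv i) := Fin.forall_fin_two.2 ⟨hu, hv⟩
  have hJuv : ∀ i, IsJHolomorphic (𝓡 4) (fun y ↦ JX y) (uv i) := Fin.forall_fin_two.2 ⟨hJu, hJv⟩
  have hFuv : ∀ i p, CoordNeZero i p → F p = uv i (affineCoordComplex i p 0) :=
    Fin.forall_fin_two.2 ⟨hF0, hF1⟩
  have hFs : ContMDiff (𝓡 (2 * 1)) (𝓡 4) ∞ F := contMDiff_glued huv hFuv
  -- the value of `F^*ωX` on the standard frame, in the preferred chart at `x`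
  set b := PiLp.basisFun 2 ℝ (Fin (2 * 1)) with hb_def
  have hval : ∀ x : ComplexProjectiveSpace 1, (ωX.pullback (𝓡 (2 * 1)) F) x b =
      ωX (uv (chartIndex x) (affineCoordComplex (chartIndex x) x 0))
        ![mfderiv 𝓘(ℝ, ℂ) (𝓡 4) (uv (chartIndex x)) (affineCoordComplex (chartIndex x) x 0) (1 : ℂ),
          JX _ (mfderiv 𝓘(ℝ, ℂ) (𝓡 4) (uv (chartIndex x))
            (affineCoordComplex (chartIndex x) x 0) (1 : ℂ))] := by
    intro x
    rw [hb_def, pullback_apply_basisFun ωX x (hFuv (chartIndex x))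
      (((huv _) _).mdifferentiableAt (by simp))]
    have hI := hJuv (chartIndex x) (affineCoordComplex (chartIndex x) x 0) 1
    rw [mul_one] at hI
    rw [hI]
  have hnonneg : ∀ x : ComplexProjectiveSpace 1, 0 ≤ (ωX.pullback (𝓡 (2 * 1)) F) x b := fun x ↦ by
    rw [hval x]
    exact htame.nonneg _ _
  -- were `u` not constant, `dF ≠ 0` somewhere
  by_contra hne
  push Not at hne
  obtain ⟨z₀, hz₀⟩ := hne
  have hex : ∃ z₁, mfderiv 𝓘(ℝ, ℂ) (𝓡 4) u z₁ ≠ 0 := by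
    by_contra h
    push Not at h
    exact hz₀ (apply_eq_apply_zero_of_mfderiv_eq_zero (hu.of_le (by exact_mod_cast le_top)) h z₀)
  obtain ⟨z₁, hz₁⟩ := hex
  set x₁ : ComplexProjectiveSpace 1 :=
    (fun z : ℂ ↦ (affineChart (n := 1) 0).symm (realCoordinates 1 fun _ ↦ z)) z₁ with hx₁
  have hFx₁ : mfderiv (𝓡 (2 * 1)) (𝓡 4) F x₁ ≠ 0 := by
    intro h0
    apply hz₁
    rw [mfderiv_eq_comp_sigma hFs hF0 z₁, ← hx₁, h0, ContinuousLinearMap.zero_comp]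
    rfl
  -- hence `du_i(1) ≠ 0` in the preferred chart at `x₁`, and `F^*ωX > 0` there
  have hξ : mfderiv 𝓘(ℝ, ℂ) (𝓡 4) (uv (chartIndex x₁))
      (affineCoordComplex (chartIndex x₁) x₁ 0) (1 : ℂ) ≠ 0 := by
    intro h0
    apply hFx₁
    rw [(hasMFDerivAt_glued x₁ (hFuv (chartIndex x₁))
      (((huv _) _).mdifferentiableAt (by simp))).mfderiv,
      mfderiv_eq_zero_of_apply_one_eq_zero (hJuv (chartIndex x₁)) h0, ContinuousLinearMap.zero_comp]
    rfl
  have hpos : 0 < (ωX.pullback (𝓡 (2 * 1)) F) x₁ b := by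
    rw [hval x₁]
    exact htame.pos _ hξ
  -- the orientation of `ℂℙ¹` given by the frame `b`
  have hbdet : (b.det : EuclideanSpace ℝ (Fin (2 * 1)) [⋀^Fin (2 * 1)]→ₗ[ℝ] ℝ) ≠ 0 := fun h ↦ by
    simpa [h] using b.det_self
  have ho := isContinuousOrientation_const_complexProjectiveSpace 1 (rayOfNeZero ℝ _ hbdet)
  have hsign : ∀ (x : ComplexProjectiveSpace 1) (w : Fin (2 * 1) → EuclideanSpace ℝ (Fin (2 * 1))),
      Real.sign (orientationForm (I := 𝓡 (2 * 1)) (M := ComplexProjectiveSpace 1)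
        (fun _ ↦ (rayOfNeZero ℝ _ hbdet : Orientation ℝ (EuclideanSpace ℝ (Fin (2 * 1))) (Fin (2 * 1)))) x w) =
        Real.sign (b.det w) := fun x w ↦
    sign_someVector_rayOfNeZero _ hbdet w
  have hne : periodFunctional ωX hω hcl
      (singularHomology.map ℤ ℤ (⟨F, hFs.continuous⟩ : C(ComplexProjectiveSpace 1, X)) (2 * 1)
        μ.fundamentalClass) ≠ 0 := by
    refine periodFunctional_map_fundamentalClass_ne_zero_of_nonneg hFs ωX hω hcl ho ?_ ?_ μ
    · intro x
      have h0 := sign_det_mul_apply_nonneg b ((ωX.pullback (𝓡 (2 * 1)) F) x).toAlternatingMap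
        (hnonneg x) (modelBasis (EuclideanSpace ℝ (Fin (2 * 1))) (2 * 1))
      convert h0 using 2
      · exact hsign x _
      · rfl
    · refine ⟨x₁, ?_⟩
      have h1 := sign_det_mul_apply_pos b ((ωX.pullback (𝓡 (2 * 1)) F) x₁).toAlternatingMap hpos
        (modelBasis (EuclideanSpace ℝ (Fin (2 * 1))) (2 * 1))
      convert h1 using 2
      · exact hsign x₁ _
      · rfl
  have hF : (⟨F, hFs.continuous⟩ : C(ComplexProjectiveSpace 1, X)) = F := rfl
  rw [hF] at hne
  exact hne hper


/-- Under the hypotheses of `twoChartSphere_const_of_period_eq_zero`, the second chart `v` is the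
same constant (`v z = u z⁻¹ = u 0` off `0`, and at `0` by continuity). [cite: McDuffSalamon2012, Lemma 2.2.1] -/
theorem twoChartSphere_const_of_period_eq_zero'
    (ωX : MForm (𝓡 4) X ℝ 2) (JX : AlmostComplexStructure (𝓡 4) ∞ X)
    (hω : IsSmoothForm ωX) (hcl : IsClosedForm ωX) (htame : JX.IsTamedBy ωX)
    {u v : ℂ → X} {F : C(ComplexProjectiveSpace 1, X)}
    (hu : ContMDiff 𝓘(ℝ, ℂ) (𝓡 4) ∞ u) (hv : ContMDiff 𝓘(ℝ, ℂ) (𝓡 4) ∞ v)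
    (huv : ∀ z : ℂ, z ≠ 0 → v z = u z⁻¹)
    (hJu : IsJHolomorphic (𝓡 4) (fun y ↦ JX y) u) (hJv : IsJHolomorphic (𝓡 4) (fun y ↦ JX y) v)
    (hF0 : ∀ p, CoordNeZero 0 p → F p = u (affineCoordComplex 0 p 0))
    (hF1 : ∀ p, CoordNeZero 1 p → F p = v (affineCoordComplex 1 p 0))
    (μ : HomologicalOrientation ℤ (ComplexProjectiveSpace 1) (2 * 1))
    (hper : periodFunctional ωX hω hcl
      (singularHomology.map ℤ ℤ F (2 * 1) μ.fundamentalClass) = 0) :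
    ∀ z, v z = u 0 := by
  have hu0 := twoChartSphere_const_of_period_eq_zero ωX JX hω hcl htame hu hv hJu hJv hF0 hF1 μ hper
  have h1 : ∀ z, z ≠ 0 → v z = u 0 := fun z hz ↦ (huv z hz).trans (hu0 _)
  intro z
  by_cases hz : z ≠ 0
  · exact h1 z hz
  push Not at hz
  subst hz
  have hcl' : IsClosed {w : ℂ | v w = u 0} := isClosed_eq hv.continuous continuous_const
  have hmem : (0 : ℂ) ∈ closure ({0}ᶜ : Set ℂ) := by
    rw [(dense_compl_singleton (0 : ℂ)).closure_eq]
    exact mem_univ _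
  exact (hcl'.closure_subset_iff.2 fun w hw ↦ h1 w hw) hmem

/-- **Positive energy**: a NON-CONSTANT `J`-holomorphic two-chart sphere has non-zero symplectic
period `⟨[ωX], F_*[ℂℙ¹]⟩ ≠ 0`, for every `ℤ`-orientation of `ℂℙ¹` (contrapositive of
`twoChartSphere_const_of_period_eq_zero`; McDuff–Salamon (2012), Lemma 2.2.1: `E(u) = ⟨[ω], [u]⟩ > 0`).
[cite: McDuffSalamon2012, Lemma 2.2.1] -/
theorem twoChartSphere_period_ne_zero_of_ne
    (ωX : MForm (𝓡 4) X ℝ 2) (JX : AlmostComplexStructure (𝓡 4) ∞ X)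
    (hω : IsSmoothForm ωX) (hcl : IsClosedForm ωX) (htame : JX.IsTamedBy ωX)
    {u v : ℂ → X} {F : C(ComplexProjectiveSpace 1, X)}
    (hu : ContMDiff 𝓘(ℝ, ℂ) (𝓡 4) ∞ u) (hv : ContMDiff 𝓘(ℝ, ℂ) (𝓡 4) ∞ v)
    (hJu : IsJHolomorphic (𝓡 4) (fun y ↦ JX y) u) (hJv : IsJHolomorphic (𝓡 4) (fun y ↦ JX y) v)
    (hF0 : ∀ p, CoordNeZero 0 p → F p = u (affineCoordComplex 0 p 0))
    (hF1 : ∀ p, CoordNeZero 1 p → F p = v (affineCoordComplex 1 p 0))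
    {z : ℂ} (hz : u z ≠ u 0) (μ : HomologicalOrientation ℤ (ComplexProjectiveSpace 1) (2 * 1)) :
    periodFunctional ωX hω hcl (singularHomology.map ℤ ℤ F (2 * 1) μ.fundamentalClass) ≠ 0 :=
  fun hper ↦ hz (twoChartSphere_const_of_period_eq_zero ωX JX hω hcl htame hu hv hJu hJv hF0 hF1 μ
    hper z)

omit [ChartedSpace (EuclideanSpace ℝ (Fin 4)) X] [T2Space X] [CompactSpace X] [IsManifold (𝓡 4) ∞ X] in
/-- A map `ℂℙ¹ → X` which is constant induces the zero map on `H₂( · ; ℤ)` (it factors through a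
point, whose homology vanishes in positive degrees; Hatcher (2002), Prop. 2.8). [folklore] -/
theorem singularHomology_map_eq_zero_of_const {F : C(ComplexProjectiveSpace 1, X)} {c : X}
    (hF : ∀ p, F p = c) : singularHomology.map ℤ ℤ F (2 * 1) = 0 := by
  have hfac : F = (ContinuousMap.const PUnit.{1} c).comp
      (ContinuousMap.const (ComplexProjectiveSpace 1) PUnit.unit) := by
    ext p
    simp [hF p]
  rw [hfac, singularHomology.map_comp,
    (isZero_singularHomology_of_subsingleton ℤ ℤ (X := PUnit.{1}) (n := 2 * 1) (by norm_num)).eq_of_src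
      (singularHomology.map ℤ ℤ (ContinuousMap.const PUnit.{1} c) (2 * 1)) 0,
    CategoryTheory.Limits.comp_zero]

/-- **A constant sphere has zero symplectic period** (its class in `H₂(X; ℤ)` is zero). [folklore] -/
theorem period_eq_zero_of_const (ωX : MForm (𝓡 4) X ℝ 2) (hω : IsSmoothForm ωX)
    (hcl : IsClosedForm ωX) {F : C(ComplexProjectiveSpace 1, X)} {c : X} (hF : ∀ p, F p = c)
    (μ : HomologicalOrientation ℤ (ComplexProjectiveSpace 1) (2 * 1)) :
    periodFunctional ωX hω hcl (singularHomology.map ℤ ℤ F (2 * 1) μ.fundamentalClass) = 0 := by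
  rw [singularHomology_map_eq_zero_of_const hF]
  simp

/-- **The symplectic period is constant on a homotopy class** (`E(u) = ⟨[ω], [u]⟩` depends only on
the homology class `[u] = u_*[ℂℙ¹]`, which homotopic maps share; McDuff–Salamon (2012), Lemma 2.2.1;
Hatcher (2002), Thm. 2.10). This is how a fixed homotopy class gives the energy bound
`sup E(uᵛ) < ∞` of McDuff–Salamon (2012), Thm. 5.3.1. [cite: McDuffSalamon2012, Lemma 2.2.1] -/
theorem period_eq_of_homotopic (ωX : MForm (𝓡 4) X ℝ 2) (hω : IsSmoothForm ωX)
    (hcl : IsClosedForm ωX) {F G : C(ComplexProjectiveSpace 1, X)} (h : F.Homotopic G)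
    (μ : HomologicalOrientation ℤ (ComplexProjectiveSpace 1) (2 * 1)) :
    periodFunctional ωX hω hcl (singularHomology.map ℤ ℤ F (2 * 1) μ.fundamentalClass) =
      periodFunctional ωX hω hcl (singularHomology.map ℤ ℤ G (2 * 1) μ.fundamentalClass) := by
  rw [singularHomology.map_eq_of_homotopic ℤ ℤ h]

/-- **Gromov compactness, dichotomy form — the case of zero energy.** Under the hypotheses of
`Literature.Geometry.Symplectic.gromovCompactness_spheres_dichotomy`, if the common class of the
spheres has zero symplectic period `⟨[ωX], (F₀)_*[ℂℙ¹]⟩ = 0` (energy `E = 0`), then alternative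
(A) holds: every sphere of the sequence is constant (`twoChartSphere_const_of_period_eq_zero`,
`period_eq_of_homotopic`), the constants have a convergent subsequence in the compact `X`, and
constant maps converge in `C(ℂℙ¹, X)` (with the identity reparametrisations). This is the trivial
stratum of McDuff–Salamon (2012), Thm. 5.3.1; the case `E > 0` is the bubbling analysis of
op. cit. Ch. 4–5 and is NOT proved here. [cite: McDuffSalamon2012, Thm. 5.3.1 and Lemma 2.2.1] -/
theorem gromovCompactness_spheres_dichotomy_of_period_eq_zero [SecondCountableTopology X]
    (ωX : MForm (𝓡 4) X ℝ 2) (JX : AlmostComplexStructure (𝓡 4) ∞ X)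
    (us vs : ℕ → ℂ → X) (Fs : ℕ → C(ComplexProjectiveSpace 1, X))
    (F₀ : C(ComplexProjectiveSpace 1, X))
    (hω : IsSmoothForm ωX) (hcl : IsClosedForm ωX) (htame : JX.IsTamedBy ωX)
    (hyp : ∀ n, ContMDiff 𝓘(ℝ, ℂ) (𝓡 4) ∞ (us n) ∧ ContMDiff 𝓘(ℝ, ℂ) (𝓡 4) ∞ (vs n) ∧
      (∀ z : ℂ, z ≠ 0 → vs n z = us n z⁻¹) ∧
      IsJHolomorphic (𝓡 4) (fun y => JX y) (us n) ∧ IsJHolomorphic (𝓡 4) (fun y => JX y) (vs n) ∧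
      (∀ p, CoordNeZero 0 p → Fs n p = us n (affineCoordComplex 0 p 0)) ∧
      (∀ p, CoordNeZero 1 p → Fs n p = vs n (affineCoordComplex 1 p 0)) ∧
      (Fs n).Homotopic F₀)
    (μ : HomologicalOrientation ℤ (ComplexProjectiveSpace 1) (2 * 1))
    (hper : periodFunctional ωX hω hcl
      (singularHomology.map ℤ ℤ F₀ (2 * 1) μ.fundamentalClass) = 0) :
    ∃ φ : ℕ → ℕ, StrictMono φ ∧
     ((∃ (u v : ℂ → X) (F : C(ComplexProjectiveSpace 1, X))
         (A : ℕ → ((Fin 2 → ℂ) ≃ₗ[ℂ] (Fin 2 → ℂ))),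
         ContMDiff 𝓘(ℝ, ℂ) (𝓡 4) ∞ u ∧ ContMDiff 𝓘(ℝ, ℂ) (𝓡 4) ∞ v ∧
         (∀ z : ℂ, z ≠ 0 → v z = u z⁻¹) ∧
         IsJHolomorphic (𝓡 4) (fun y => JX y) u ∧ IsJHolomorphic (𝓡 4) (fun y => JX y) v ∧
         (∀ p, CoordNeZero 0 p → F p = u (affineCoordComplex 0 p 0)) ∧
         (∀ p, CoordNeZero 1 p → F p = v (affineCoordComplex 1 p 0)) ∧
         Filter.Tendsto (fun k => (Fs (φ k)).comp
           ⟨PlusOneSpherePair.projectiveMap (A k), PlusOneSpherePair.continuous_projectiveMap (A k)⟩)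
           Filter.atTop (𝓝 F)) ∨
      (∃ (m : ℕ) (Bu Bv : Fin m → ℂ → X) (G : Fin m → C(ComplexProjectiveSpace 1, X)), 2 ≤ m ∧
         (∀ j, ContMDiff 𝓘(ℝ, ℂ) (𝓡 4) ∞ (Bu j) ∧ ContMDiff 𝓘(ℝ, ℂ) (𝓡 4) ∞ (Bv j) ∧
           (∀ z : ℂ, z ≠ 0 → Bv j z = Bu j z⁻¹) ∧
           IsJHolomorphic (𝓡 4) (fun y => JX y) (Bu j) ∧ IsJHolomorphic (𝓡 4) (fun y => JX y) (Bv j) ∧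
           (∃ z, Bu j z ≠ Bu j 0) ∧
           (∀ p, CoordNeZero 0 p → G j p = Bu j (affineCoordComplex 0 p 0)) ∧
           (∀ p, CoordNeZero 1 p → G j p = Bv j (affineCoordComplex 1 p 0))) ∧
         (∀ n, ∑ j, singularHomology.map ℤ ℤ (G j) (2 * 1)
             (ComplexProjectiveSpace.homologicalOrientationInt 1).fundamentalClass =
           singularHomology.map ℤ ℤ (Fs n) (2 * 1)
             (ComplexProjectiveSpace.homologicalOrientationInt 1).fundamentalClass) ∧
         (∀ O : Set X, IsOpen O → (⋃ j, (range (Bu j) ∪ {Bv j 0})) ⊆ O →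
           ∀ᶠ k in Filter.atTop, range (us (φ k)) ∪ {vs (φ k) 0} ⊆ O) ∧
         (∀ y ∈ ⋃ j, (range (Bu j) ∪ {Bv j 0}), ∀ O' : Set X, IsOpen O' → y ∈ O' →
           ∀ᶠ k in Filter.atTop, ((range (us (φ k)) ∪ {vs (φ k) 0}) ∩ O').Nonempty))) := by
  -- every sphere of the sequence has zero period, hence is constant
  have hper_n : ∀ n, periodFunctional ωX hω hcl
      (singularHomology.map ℤ ℤ (Fs n) (2 * 1) μ.fundamentalClass) = 0 :=
    fun n ↦ (period_eq_of_homotopic ωX hω hcl (hyp n).2.2.2.2.2.2.2 μ).trans hper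
  have hcu : ∀ n z, us n z = us n 0 := fun n ↦
    twoChartSphere_const_of_period_eq_zero ωX JX hω hcl htame (hyp n).1 (hyp n).2.1
      (hyp n).2.2.2.1 (hyp n).2.2.2.2.1 (hyp n).2.2.2.2.2.1 (hyp n).2.2.2.2.2.2.1 μ (hper_n n)
  have hcv : ∀ n z, vs n z = us n 0 := fun n ↦
    twoChartSphere_const_of_period_eq_zero' ωX JX hω hcl htame (hyp n).1 (hyp n).2.1
      (hyp n).2.2.1 (hyp n).2.2.2.1 (hyp n).2.2.2.2.1 (hyp n).2.2.2.2.2.1 (hyp n).2.2.2.2.2.2.1 μ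
      (hper_n n)
  have hFs : ∀ n p, Fs n p = us n 0 := by
    intro n p
    obtain ⟨i, hi⟩ := exists_coordNeZero p
    fin_cases i
    · exact ((hyp n).2.2.2.2.2.1 p hi).trans (hcu n _)
    · exact ((hyp n).2.2.2.2.2.2.1 p hi).trans (hcv n _)
  -- a convergent subsequence of the constants
  obtain ⟨a, -, φ, hφ, hlim⟩ :=
    isCompact_univ.tendsto_subseq (x := fun n ↦ us n 0) fun n ↦ mem_univ _
  refine ⟨φ, hφ, Or.inl ⟨fun _ ↦ a, fun _ ↦ a, ContinuousMap.const _ a,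
    fun _ ↦ LinearEquiv.refl ℂ _, contMDiff_const, contMDiff_const, fun _ _ ↦ rfl, ?_, ?_,
    fun _ _ ↦ rfl, fun _ _ ↦ rfl, ?_⟩⟩
  · intro z ζ
    simp [mfderiv_const]
  · intro z ζ
    simp [mfderiv_const]
  · have heq : ∀ k, (Fs (φ k)).comp ⟨PlusOneSpherePair.projectiveMap (LinearEquiv.refl ℂ _),
        PlusOneSpherePair.continuous_projectiveMap _⟩ =
          ContinuousMap.const (ComplexProjectiveSpace 1) (us (φ k) 0) := by
      intro k
      ext p
      exact hFs (φ k) _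
    exact ((ContinuousMap.continuous_const'.tendsto a).comp hlim).congr fun k ↦ (heq k).symm

end TwoChart

end Literature.Geometry.Symplectic

end
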